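import Mathlib
import Literature.MathematicalPhysics.QuantumFieldTheory.StrongCouplingActivities

/-!
# LatticeQCDFlow / Scaling — Haar tools for a compact gauge group: averaging one bond of a finite
# Haar product, and the ONE-LINK INTEGRALS of a matrix representation

HONEST FRAMING: exact (Metropolis-corrected) sampling algorithms for lattice gauge theory;
figures of merit are autocorrelation/cost numbers at stated couplings and volumes; no
continuum-physics claim.

Venture `LatticeQCDFlow` (cell pub-lqcd), topic `Scaling`, FANOUT row 30 (lean-1) — OUR WORK, file
1 of the extension of the slab-chain proof of (LC)/(U′) (`Scaling/U1CrossCutFloorAllT.lean`, `U(1)`)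
to a GENERAL compact gauge group `G` with a continuous matrix representation `ρ`.  Two tools.
(1) AVERAGING ONE BOND of a finite Haar product `Haar^{⊗ι}` (`integral_pi_eq_integral_average`):
`∫ F(u) du = ∫ (∫ F(g •ᵢ u) dg) du`, where `g •ᵢ u = Pi.mulSingle i g * u` multiplies the `i`-th
bond by `g` on the left — left invariance of the product and Fubini; every vanishing / constancy
statement of the sequel files is an evaluation of the inner integral by translation invariance of
`Haar(G)`.  (2) THE ONE-LINK DATA of `ρ` (`OneLink ρ θ`): `ρ` continuous, `tr ρ(g⁻¹) = conj tr ρ(g)`,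
`∫ Re tr ρ = 0`, and the Schur-type identity `∫ Re tr ρ(g) · ρ(g)_{ab} dg = θ δ_{ab}` with a real
scalar `θ` (for `U(1)`: `θ = 1/2`; for `SU(N)`, `N ≥ 3`: `θ = 1/(2N)`; for `SU(2)`: `θ = 1/2`).
Consequences: `trRe_inv`, `trRe_comm` (class function), `integral_trRe_mul/‥_inv` (`∫ Re tr ρ(a g b)
dg = 0`), **`integral_trRe_mul_trace`** (`∫ Re tr ρ(g) · tr(X ρ(g) Y) dg = θ tr(XY)`, and with
`ρ(g⁻¹)`), **`integral_trRe_sq`** (`∫ (Re tr ρ)² = N θ`) and **`theta_pos`** (`θ > 0` for `N ≥ 1`,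
positivity of Haar measure on open sets).  These are the only properties of the gauge group the
slab-chain proof uses [cite: MontvayMunster1994, §3.6.2].  Elementary; nothing is cited as a fact;
`def` `trRe`, structure `OneLink`; no `sorry`.
-/

noncomputable section

open MeasureTheory Filter Finset
open Literature.MathematicalPhysics.QuantumFieldTheory

namespace Summit.Ventures.LatticeQCDFlow.Theory2.GroupLayer

variable {G : Type*} [Group G] [TopologicalSpace G] [IsTopologicalGroup G] [CompactSpace G]
  [MeasurableSpace G] [BorelSpace G]

/-! ## 1. Averaging one bond of a finite Haar product -/

section Average

variable [SecondCountableTopology G] {ι : Type*} [Fintype ι] [DecidableEq ι]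

omit [IsTopologicalGroup G] [CompactSpace G] [MeasurableSpace G] [BorelSpace G]
  [SecondCountableTopology G] [Fintype ι] in
/-- `(g, u) ↦ g •ᵢ u = Pi.mulSingle i g * u` is continuous. [folklore] -/
theorem continuous_mulSingle_mul [ContinuousMul G] (i : ι) :
    Continuous fun p : G × (ι → G) => (Pi.mulSingle i p.1 : ι → G) * p.2 := by
  refine continuous_pi fun j => ?_
  simp only [Pi.mul_apply, Pi.mulSingle_apply]
  by_cases hj : j = i
  · simp only [hj, if_true]
    exact continuous_fst.mul ((continuous_apply i).comp continuous_snd)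
  · simp only [hj, if_false, one_mul]
    exact (continuous_apply j).comp continuous_snd

omit [TopologicalSpace G] [IsTopologicalGroup G] [CompactSpace G] [MeasurableSpace G] [BorelSpace G]
  [SecondCountableTopology G] [Fintype ι] in
/-- The `i`-th bond of `g •ᵢ u` is `g · u i`. [folklore] -/
@[simp] theorem mulSingle_mul_apply_same (i : ι) (g : G) (u : ι → G) :
    ((Pi.mulSingle i g : ι → G) * u) i = g * u i := by
  simp

omit [TopologicalSpace G] [IsTopologicalGroup G] [CompactSpace G] [MeasurableSpace G] [BorelSpace G]
  [SecondCountableTopology G] [Fintype ι] in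
/-- The other bonds of `g •ᵢ u` are those of `u`. [folklore] -/
@[simp] theorem mulSingle_mul_apply_ne {i j : ι} (hj : j ≠ i) (g : G) (u : ι → G) :
    ((Pi.mulSingle i g : ι → G) * u) j = u j := by
  simp [hj]

/-- **Averaging one bond**: for a bounded measurable `F` on the Haar product,
`∫ F(u) du = ∫ (∫ F(g •ᵢ u) dg) du` (left invariance of the product under `Pi.mulSingle i g` and
Fubini). [folklore] -/
theorem integral_pi_eq_integral_average (i : ι) {F : (ι → G) → ℂ} (hFm : Measurable F) {M : ℝ}
    (hFb : ∀ u, ‖F u‖ ≤ M) :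
    ∫ u, F u ∂(Measure.pi fun _ : ι => haarProbability G) =
      ∫ u, (∫ g, F ((Pi.mulSingle i g : ι → G) * u) ∂haarProbability G)
        ∂(Measure.pi fun _ : ι => haarProbability G) := by
  have hm : Measurable (Function.uncurry fun (g : G) (u : ι → G) =>
      F ((Pi.mulSingle i g : ι → G) * u)) :=
    hFm.comp (continuous_mulSingle_mul i).measurable
  have hint : Integrable (Function.uncurry fun (g : G) (u : ι → G) =>
      F ((Pi.mulSingle i g : ι → G) * u))
      ((haarProbability G).prod (Measure.pi fun _ : ι => haarProbability G)) :=
    Integrable.of_bound hm.aestronglyMeasurable M (Eventually.of_forall fun p => hFb _)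
  calc ∫ u, F u ∂(Measure.pi fun _ : ι => haarProbability G)
      = ∫ _g, (∫ u, F u ∂(Measure.pi fun _ : ι => haarProbability G)) ∂haarProbability G := by
        rw [integral_const, probReal_univ, one_smul]
    _ = ∫ g, (∫ u, F ((Pi.mulSingle i g : ι → G) * u) ∂(Measure.pi fun _ : ι => haarProbability G))
          ∂haarProbability G := by
        refine integral_congr_ae (Eventually.of_forall fun g => ?_)
        exact (integral_mul_left_eq_self F (Pi.mulSingle i g : ι → G)).symm
    _ = ∫ u, (∫ g, F ((Pi.mulSingle i g : ι → G) * u) ∂haarProbability G)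
          ∂(Measure.pi fun _ : ι => haarProbability G) := integral_integral_swap hint

/-- **Averaging one bond, constant inner integral**: if `∫ F(g •ᵢ u) dg = c` for every `u`, then
`∫ F = c`. [folklore] -/
theorem integral_pi_eq_of_average_eq (i : ι) {F : (ι → G) → ℂ} (hFm : Measurable F) {M : ℝ}
    (hFb : ∀ u, ‖F u‖ ≤ M) {c : ℂ}
    (hc : ∀ u, ∫ g, F ((Pi.mulSingle i g : ι → G) * u) ∂haarProbability G = c) :
    ∫ u, F u ∂(Measure.pi fun _ : ι => haarProbability G) = c := by
  rw [integral_pi_eq_integral_average i hFm hFb]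
  simp_rw [hc]
  rw [integral_const, probReal_univ, one_smul]

end Average

/-! ## 2. The one-link integrals of a matrix representation -/

section OneLink

variable {N : ℕ} (ρ : G →* Matrix (Fin N) (Fin N) ℂ)

/-- The real part of the character, `Re tr ρ(g)`. [folklore] -/
def trRe (g : G) : ℝ := (ρ g).trace.re

omit [TopologicalSpace G] [IsTopologicalGroup G] [CompactSpace G] [MeasurableSpace G] [BorelSpace G] in
/-- `trRe` unfolded. [folklore] -/
theorem trRe_apply (g : G) : trRe ρ g = (ρ g).trace.re := rfl

/-- **The one-link data of a representation.**  `ρ` is continuous, its character satisfies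
`tr ρ(g⁻¹) = conj tr ρ(g)` (unitarity), `∫ Re tr ρ dg = 0` (no invariants), and the Schur-type
identity `∫ Re tr ρ(g) ρ(g)_{ab} dg = θ δ_{ab}` with the real scalar `θ` (irreducibility).
[folklore] -/
structure OneLink (θ : ℝ) : Prop where
  /-- `ρ` is continuous -/
  cont : Continuous ρ
  /-- the character of the inverse is the conjugate character -/
  trace_inv : ∀ g : G, (ρ g⁻¹).trace = star (ρ g).trace
  /-- the character has mean zero -/
  integral_trRe : ∫ g, trRe ρ g ∂haarProbability G = 0
  /-- the Schur-type one-link integral -/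
  integral_trRe_entry : ∀ a b : Fin N,
    ∫ g, (trRe ρ g : ℂ) * ρ g a b ∂haarProbability G = if a = b then (θ : ℂ) else 0

omit [TopologicalSpace G] [IsTopologicalGroup G] [CompactSpace G] [MeasurableSpace G] [BorelSpace G] in
/-- `Re tr ρ` is a class function: `Re tr ρ(g h) = Re tr ρ(h g)`. [folklore] -/
theorem trRe_comm (g h : G) : trRe ρ (g * h) = trRe ρ (h * g) := by
  rw [trRe, trRe, map_mul, map_mul, Matrix.trace_mul_comm]

omit [TopologicalSpace G] [IsTopologicalGroup G] [CompactSpace G] [MeasurableSpace G] [BorelSpace G] in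
/-- `Re tr ρ` is invariant under conjugation. [folklore] -/
theorem trRe_conj (a g : G) : trRe ρ (a * g * a⁻¹) = trRe ρ g := by
  rw [trRe_comm, ← mul_assoc, inv_mul_cancel, one_mul]

omit [IsTopologicalGroup G] [CompactSpace G] [MeasurableSpace G] [BorelSpace G] in
/-- `Re tr ρ` is continuous for continuous `ρ`. [folklore] -/
theorem continuous_trRe (hρ : Continuous ρ) : Continuous (trRe ρ) :=
  continuous_trace_re ρ hρ

variable {ρ} {θ : ℝ}

omit [TopologicalSpace G] [IsTopologicalGroup G] [CompactSpace G] [MeasurableSpace G] [BorelSpace G] in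
/-- Under the one-link data, `Re tr ρ(g⁻¹) = Re tr ρ(g)`. [folklore] -/
theorem trRe_inv (hρ : ∀ g : G, (ρ g⁻¹).trace = star (ρ g).trace) (g : G) :
    trRe ρ g⁻¹ = trRe ρ g := by
  rw [trRe, trRe, hρ g, Complex.star_def, Complex.conj_re]

omit [TopologicalSpace G] [IsTopologicalGroup G] [CompactSpace G] [MeasurableSpace G] [BorelSpace G] in
/-- Under the one-link data, `Re tr ρ(g) = (tr ρ(g) + tr ρ(g⁻¹))/2` as a complex number. [folklore] -/
theorem trRe_eq_half_add (hρ : ∀ g : G, (ρ g⁻¹).trace = star (ρ g).trace) (g : G) :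
    (trRe ρ g : ℂ) = 2⁻¹ * ((ρ g).trace + (ρ g⁻¹).trace) := by
  rw [trRe, hρ g, Complex.star_def, Complex.add_conj]
  push_cast
  ring

/-- **A single letter integrates to zero**: `∫ Re tr ρ(a g b) dg = 0`. [folklore] -/
theorem integral_trRe_mul (h : OneLink ρ θ) (a b : G) :
    ∫ g, (trRe ρ (a * g * b) : ℂ) ∂haarProbability G = 0 := by
  have h1 := integral_haar_conj_eq (G := G) (fun g => (trRe ρ g : ℂ)) a b
  rw [h1, integral_complex_ofReal, h.integral_trRe, Complex.ofReal_zero]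

/-- **A single inverted letter integrates to zero**: `∫ Re tr ρ(a g⁻¹ b) dg = 0`. [folklore] -/
theorem integral_trRe_mul_inv (h : OneLink ρ θ) (a b : G) :
    ∫ g, (trRe ρ (a * g⁻¹ * b) : ℂ) ∂haarProbability G = 0 := by
  have h1 := integral_haar_conj_inv_eq (G := G) (fun g => (trRe ρ g : ℂ)) a b
  rw [h1, integral_complex_ofReal, h.integral_trRe, Complex.ofReal_zero]

omit [IsTopologicalGroup G] [CompactSpace G] [MeasurableSpace G] [BorelSpace G] in
/-- Every matrix entry of a continuous representation is continuous. [folklore] -/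
theorem continuous_entry (hρ : Continuous ρ) (a b : Fin N) : Continuous fun g : G => ρ g a b :=
  (continuous_apply_apply a b).comp hρ

/-- `g ↦ Re tr ρ(g) · ρ(g)_{ab}` is integrable. [folklore] -/
theorem integrable_trRe_mul_entry (hρ : Continuous ρ) (a b : Fin N) :
    Integrable (fun g : G => (trRe ρ g : ℂ) * ρ g a b) (haarProbability G) :=
  ((Complex.continuous_ofReal.comp (continuous_trRe ρ hρ)).mul
    (continuous_entry hρ a b)).integrable_of_hasCompactSupport (HasCompactSupport.of_compactSpace _)

/-- **The Schur-type one-link integral in matrix form**: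
`∫ Re tr ρ(g) · tr(X ρ(g) Y) dg = θ · tr(X Y)`. [folklore] -/
theorem integral_trRe_mul_trace (h : OneLink ρ θ) (X Y : Matrix (Fin N) (Fin N) ℂ) :
    ∫ g, (trRe ρ g : ℂ) * (X * ρ g * Y).trace ∂haarProbability G = θ * (X * Y).trace := by
  -- expand the trace in entries
  have hexp : ∀ g : G, (trRe ρ g : ℂ) * (X * ρ g * Y).trace =
      ∑ c, ∑ b, ∑ a, X c a * Y b c * ((trRe ρ g : ℂ) * ρ g a b) := by
    intro g
    simp only [Matrix.trace, Matrix.diag, Matrix.mul_apply, Finset.mul_sum, Finset.sum_mul]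
    exact sum_congr rfl fun c _ => sum_congr rfl fun b _ => sum_congr rfl fun a _ => by ring
  simp_rw [hexp]
  have hi : ∀ (c b a : Fin N), Integrable (fun g : G => X c a * Y b c * ((trRe ρ g : ℂ) * ρ g a b))
      (haarProbability G) := fun c b a => (integrable_trRe_mul_entry h.cont a b).const_mul _
  rw [integral_finsetSum _ fun c _ => integrable_finsetSum _ fun b _ =>
    integrable_finsetSum _ fun a _ => hi c b a]
  simp_rw [integral_finsetSum _ fun b _ => integrable_finsetSum _ fun a _ => hi _ b a,
    integral_finsetSum _ fun a _ => hi _ _ a, integral_const_mul, h.integral_trRe_entry]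
  have hR : (θ : ℂ) * (X * Y).trace = ∑ c, ∑ a, X c a * Y a c * θ := by
    simp only [Matrix.trace, Matrix.diag, Matrix.mul_apply, Finset.mul_sum]
    exact sum_congr rfl fun c _ => sum_congr rfl fun a _ => by ring
  rw [hR]
  refine sum_congr rfl fun c _ => ?_
  rw [Finset.sum_comm]
  refine sum_congr rfl fun a _ => ?_
  simp only [mul_ite, mul_zero, Finset.sum_ite_eq, Finset.mem_univ, if_true]

/-- **The Schur-type one-link integral, inverted letter**:
`∫ Re tr ρ(g) · tr(X ρ(g⁻¹) Y) dg = θ · tr(X Y)`. [folklore] -/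
theorem integral_trRe_mul_trace_inv (h : OneLink ρ θ) (X Y : Matrix (Fin N) (Fin N) ℂ) :
    ∫ g, (trRe ρ g : ℂ) * (X * ρ g⁻¹ * Y).trace ∂haarProbability G = θ * (X * Y).trace := by
  have h1 := integral_inv_eq_self (fun g : G => (trRe ρ g : ℂ) * (X * ρ g⁻¹ * Y).trace)
    (haarProbability G)
  simp only [inv_inv, trRe_inv h.trace_inv] at h1
  rw [← h1]
  exact integral_trRe_mul_trace h X Y

/-- The Schur-type one-link integral against the full character: `∫ Re tr ρ(g) · tr ρ(g) = N θ`.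
[folklore] -/
theorem integral_trRe_mul_trace_self (h : OneLink ρ θ) :
    ∫ g, (trRe ρ g : ℂ) * (ρ g).trace ∂haarProbability G = N * θ := by
  have h1 := integral_trRe_mul_trace h 1 1
  simp only [Matrix.one_mul, Matrix.mul_one, Matrix.trace_one, Fintype.card_fin] at h1
  rw [h1, mul_comm]

/-- **The second moment of the character**: `∫ (Re tr ρ)² dg = N θ`. [folklore] -/
theorem integral_trRe_sq (h : OneLink ρ θ) :
    ∫ g, trRe ρ g ^ 2 ∂haarProbability G = N * θ := by
  -- `2 Re tr ρ(g) = tr ρ(g) + tr ρ(g⁻¹)`; both terms integrate against `Re tr ρ` to `N θ`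
  have h2 : ∫ g, (trRe ρ g : ℂ) * (ρ g⁻¹).trace ∂haarProbability G = N * θ := by
    have h1 := integral_inv_eq_self (fun g : G => (trRe ρ g : ℂ) * (ρ g⁻¹).trace)
      (haarProbability G)
    simp only [inv_inv, trRe_inv h.trace_inv] at h1
    rw [← h1]
    exact integral_trRe_mul_trace_self h
  have hsq : ∀ g : G, ((trRe ρ g ^ 2 : ℝ) : ℂ) =
      2⁻¹ * ((trRe ρ g : ℂ) * (ρ g).trace) + 2⁻¹ * ((trRe ρ g : ℂ) * (ρ g⁻¹).trace) := by
    intro g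
    have hh := trRe_eq_half_add h.trace_inv g
    push_cast
    rw [sq]
    nth_rewrite 2 [hh]
    ring
  have hi1 : Integrable (fun g : G => (trRe ρ g : ℂ) * (ρ g).trace) (haarProbability G) :=
    ((Complex.continuous_ofReal.comp (continuous_trRe ρ h.cont)).mul
      h.cont.matrix_trace).integrable_of_hasCompactSupport (HasCompactSupport.of_compactSpace _)
  have hi2 : Integrable (fun g : G => (trRe ρ g : ℂ) * (ρ g⁻¹).trace) (haarProbability G) :=
    ((Complex.continuous_ofReal.comp (continuous_trRe ρ h.cont)).mul
      ((h.cont.comp continuous_inv).matrix_trace)).integrable_of_hasCompactSupport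
      (HasCompactSupport.of_compactSpace _)
  apply Complex.ofReal_injective
  rw [← integral_complex_ofReal]
  simp_rw [hsq]
  rw [integral_add (hi1.const_mul _) (hi2.const_mul _), integral_const_mul, integral_const_mul,
    integral_trRe_mul_trace_self h, h2]
  push_cast
  ring

/-- **The second moment of the character is positive** (`N ≥ 1`): `Re tr ρ` is continuous, equals
`N` at the identity, and Haar measure charges open sets. [folklore] -/
theorem integral_trRe_sq_pos [NeZero N] (hρ : Continuous ρ) :
    0 < ∫ g, trRe ρ g ^ 2 ∂haarProbability G := by
  have hc : Continuous fun g : G => trRe ρ g ^ 2 := (continuous_trRe ρ hρ).pow 2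
  have hnn : 0 ≤ fun g : G => trRe ρ g ^ 2 := fun g => sq_nonneg _
  have hne : trRe ρ (1 : G) ^ 2 ≠ 0 := by
    have h1 : trRe ρ (1 : G) = N := by
      simp [trRe, map_one, Matrix.trace_one, Fintype.card_fin]
    rw [h1]
    exact pow_ne_zero 2 (Nat.cast_ne_zero.2 (NeZero.ne N))
  exact hc.integral_pos_of_hasCompactSupport_nonneg_nonzero (HasCompactSupport.of_compactSpace _)
    hnn hne

/-- **`θ > 0`** under the one-link data (`N ≥ 1`). [folklore] -/
theorem theta_pos [NeZero N] (h : OneLink ρ θ) : 0 < θ := by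
  have h1 := integral_trRe_sq_pos (G := G) (ρ := ρ) h.cont
  rw [integral_trRe_sq h] at h1
  have hN : (0 : ℝ) < N := Nat.cast_pos.2 (Nat.pos_of_ne_zero (NeZero.ne N))
  exact pos_of_mul_pos_right h1 hN.le

omit [IsTopologicalGroup G] [MeasurableSpace G] [BorelSpace G] in
/-- A uniform bound on `|Re tr ρ|`. [folklore] -/
theorem exists_trRe_bound (hρ : Continuous ρ) : ∃ B : ℝ, 0 ≤ B ∧ ∀ g : G, |trRe ρ g| ≤ B :=
  exists_bound_trace_re_nonneg ρ hρ

omit [IsTopologicalGroup G] [MeasurableSpace G] [BorelSpace G] in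
/-- The chosen uniform bound `trReBound` on `|Re tr ρ|`. [folklore] -/
def trReBound (hρ : Continuous ρ) : ℝ := Classical.choose (exists_trRe_bound (G := G) hρ)

omit [IsTopologicalGroup G] [MeasurableSpace G] [BorelSpace G] in
/-- `trReBound ≥ 0`. [folklore] -/
theorem trReBound_nonneg (hρ : Continuous ρ) : 0 ≤ trReBound (G := G) (ρ := ρ) hρ :=
  (Classical.choose_spec (exists_trRe_bound (G := G) hρ)).1

omit [IsTopologicalGroup G] [MeasurableSpace G] [BorelSpace G] in
/-- `|Re tr ρ(g)| ≤ trReBound`. [folklore] -/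
theorem abs_trRe_le (hρ : Continuous ρ) (g : G) : |trRe ρ g| ≤ trReBound (G := G) (ρ := ρ) hρ :=
  (Classical.choose_spec (exists_trRe_bound (G := G) hρ)).2 g

end OneLink

end Summit.Ventures.LatticeQCDFlow.Theory2.GroupLayer

end
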